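import Summits.AtomisticToContinuum.FouriersLaw.Theorems.BondHeatUncertaintyBoundedResponseParitySectorSplit
import HarnessLib

/-!
(SPLIT FOR THE 400-LINE CAP by the landing lane, hand-2 g37: this file = part 1 of 2 (§0 parity bookkeeping, §1 the Green–Kubo pairing sees only the odd sector, §2 response coefficient and escape deficit as pairings); the sequel `…OddSectorGreenKubo` (§3 CORE, §4 odd-sector ladder, §5 current-corrector ladder through the odd sector, §6 sharpness) imports it; cut at §3 rather than §4 so that both parts respect the cap; the module docstring stays here; same namespace / section / opens / variables, all FQNs unchanged.)
# BondHeatUncertainty / BoundedResponse — «OddSectorGreenKubo» (lens-1 «grading / quantitative ladder», gen 102 NODE)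

RESIDUAL MODE, line `N_F = FouriersLaw`; blocker 11071 `BoundedResponse` (with the common leg of 9121).

## The node in one paragraph

The Green–Kubo pairing of the tree (`CorrectorTheory` B + `pinnedChain_integral_corrector_mul_withDensity`:
`⟨u, J⟩_{e^{-H/T}} = Z·(N−1)T²·D_N`, `u = u_N` the Kubo corrector of the total current `J = Σ_i j_i`) only sees the
`Θ`-ODD part of `u_N` (`J∘Θ = −J`, `Θ(q,p) = (q,−p)`), and by the tree's committor identity
(`kinCorrector_committor_ae_eq`: `γ(N−1)h₀ = Σ_b (E_{≤b} − ⟨E_{≤b}⟩) − u_N` a.e., block energies `Θ`-EVEN) the odd part of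
`u_N` is `−γ(N−1)·h₀^odd`.  Hence, at every fixed `N ≥ 2` and along EVERY steady-state family,

  `T²·D_N = −γ·⟨h₀, J⟩_{μ_T} = −(γ/2)·⟨h₀ − h₀∘Θ, J⟩_{μ_T}`        (`response_eq_neg_corrector_current_pairing`),
  `E_N = −⟨h₀ − h₀∘Θ, J⟩_{μ_T} / (2T²(N−1))`                        (`escapeDeficit_eq_oddCorrector_current_pairing`),

and with Cauchy–Schwarz and the landed statics `‖J‖²_{μ_T} ≤ C_J·N` (`exists_totalCurrent_sq_le`) the CORE fixed-`N` inequality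

  `E_N² ≤ (C_J/(4T⁴)) · N/(N−1)² · oddDefect(μ_T)(h₀)`              (`sq_escapeDeficit_le_oddDefect`).

So the ODD-SECTOR GRADE of g101 (`OddCorrectorGrade s`: `oddDefect(μ_T^N) h₀ ≤ C·N^s` eventually) feeds the exponent ladder of
gen 55 WITHOUT any time-side co-hypothesis:

  `OddCorrectorGrade s ⟹ ExponentFloor ((1 − s)/2)`                  (`exponentFloor_of_oddCorrectorGrade`),
  `OddCorrectorGrade (−1) ⟹ BoundedResponse` (11071)                 (`boundedResponse_of_oddCorrectorGrade_neg_one`),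
  `OddCorrectorGrade 0 ⟹ HalfOhmicFloor`                              (`halfOhmicFloor_of_oddCorrectorGrade_zero`),
  `CurrentCorrectorBudget a ⟹ OddCorrectorGrade (a − 2)`              (`oddCorrectorGrade_of_currentCorrectorBudget`):

gen 57's ladder `CCB(a) ⟹ F((3−a)/2)` FACTORS through the odd sector (`exponentFloor_of_currentCorrectorBudget_via_oddSector`), and
E1 `ConeScaleCorrector` gives `OddCorrectorGrade 0` (`oddCorrectorGrade_zero_of_coneScaleCorrector`).

## Target and pieces (tags in the decl docstrings)

Target ⟸ pieces:  11071 `BoundedResponse` ⟸ (O₋₁ᶜ) `OddCorrectorGrade (−1)` «INTENSIVE ODD CORRECTOR» — one piece, plus the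
graded family (Oᶜ_s), `−1 < s < 1`, each feeding the WEAKER rung `F((1−s)/2)` of 11071, and the bigraded doors
`(Oᶜ_s) ∧ B((1−s)/2) ⟹ 11071` (`boundedResponse_of_oddCorrectorGrade_of_bootstrap`).

* (O₋₁ᶜ) `OddCorrectorGrade (−1)`: UNDECIDED (stated test: the two-replica estimator of `N ↦ oddDefect(μ_T^N) h₀` has log–log
  slope `−1` (diffusive: local current correctors with summable correlations make `‖h₀^odd‖² ≍ c(T)/N`) versus `+1` (phonon
  corner: `oddDefect ≈ 0.32·N`, g101 census)) · INSTRUMENTABLE (same estimator as (O₁ᶜ)) · SUFFICIENT for 11071 and — honest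
  flag — STRONGER-LEANING, not known NECESSARY: 11071 constrains the single pairing `⟨h₀^odd, J⟩`, (O₋₁ᶜ) the whole odd norm;
  the converse would need the saturation of Cauchy–Schwarz (`h₀^odd ∥ J` to leading order), which is open.  phonon-FALSE, as
  11071 is.  TIME-FREE: no `LeakPoint` / `DeficitCesaroGrade` / `TransientFloor` leg (all tree maps from odd grades need one).
* (Oᶜ_s), `−1 < s < 1`: WEAKER than 11071's currency only through `F((1−s)/2) < F(1)` (each such rung is implied by 11071,
  `exponentFloor_of_boundedResponse`, and not known to imply it); UNDECIDED with the same test (slope `s`).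
* (Oᶜ_0) is implied by E1 (PROVED direction `oddCorrectorGrade_zero_of_coneScaleCorrector`; E1 itself open) and gives F(1/2).
* Sharpness of the CORE read backwards («a conductor forces odd weight»): wherever `E_N ≥ e₀ > 0` eventually (phonon corner,
  `EscapeInfZero` false) every (Oᶜ_s), `s < 1`, is FALSE (`not_oddCorrectorGrade_of_escapeFloor`).

Proposed residual set for the line: `N_F ⟸ (O₋₁ᶜ) ∧ S1r′` (two pieces; drops (D_F) [IDEA-NEEDED] and (E₁ᶜ) of door v7), offered
to the critic as (A) an ALTERNATIVE door of record for 11071 or (B) a graded FEEDER of door v7 (like gen 57 (7c)).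

Further doors: `(Oᶜ_s) ∧ BufferedJunctionLaw ⟹ 11071` for `−1 ≤ s < 1` (`boundedResponse_of_oddCorrectorGrade_of_bufferedJunctionLaw`,
tree kernel of the junction-defect bigrading), and the 9121 leg is kept: (O₋₁ᶜ) ⟹ (O₁ᶜ) = S4o (`oddCorrectorGrade_one_of_neg_one`,
g101 `oddCorrectorBound_of_oddCorrectorGrade_one`).

Why this is novel (w.r.t. the tree and the other lenses' nodes): the tree pairs `u_N` with `J` (gen 57, `CurrentCorrectorBudget`)
or grades `h₀` in full norm / even–odd at `s = 1` with a TIME-side partner (g99–g101); nobody had used that `J` is `Θ`-odd while the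
committor part of `u_N` is `Θ`-even, which converts the odd-sector SIZE of `h₀` alone into decay of `E_N` at fixed `N`.

Why each piece is strictly weaker than the summit (doctrine: not known to imply it, not barrier-excluded): every (Oᶜ_s) is a
statement about ONE equilibrium object — the `Θ`-odd part of the Kubo corrector of the left contact observable under `μ_T^N` — and
its best known consequence is the single item 11071 of route `BondHeatUncertainty` (this file), never `FouriersLaw` (which needs
the conductivity limit and the profile).  Barrier placement (`Literature/Barriers/AtomisticToContinuum`): `BoundaryTapNormPersistence`
(with its odd-sector instance `not_OddCorrectorDecay`) and `SpectralGapClosingEquilibrium.equilibrium_rate_bound` forbid `N`-UNIFORM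
TIME-DECAY RATES of extensive observables under the two end taps — every (Oᶜ_s) is a TIME-FREE statement about the size of the
`t = ∞` corrector `h₀` of a LOCAL observable, outside that technique class (this is exactly why the node has no `LeakPoint` /
transient leg); `MazurBoundBallisticOpenChain` / `HarmonicCrystalBallistic` describe the ballistic corner `lam = β = 0`, where (Oᶜ_s),
`s < 1`, is honestly FALSE (§6) — the pieces quantify only over `0 < lam, 0 < β`, as 11071 does.  Relative to the ITEM 11071 the piece
(O₋₁ᶜ) is flagged SUFFICIENT / stronger-leaning (above), honestly.

All objects are the tree's; 0 new `def`s; every proof kernel-checked on the standard axioms.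
-/

noncomputable section

open MeasureTheory ProbabilityTheory Filter Topology Set Function
open scoped NNReal ENNReal
open Literature.MathematicalPhysics.KineticTheory.HeatConduction
open Literature.MathematicalPhysics.KineticTheory OscillatorChain
open Literature.MathematicalPhysics.KineticTheory.HeatConduction.HardTether (leftEnergy blockWeight bondWeight)
open Summit.AtomisticToContinuum.FouriersLaw.Theorems.SubdiffusiveBondHeat
open Summit.AtomisticToContinuum.FouriersLaw.Theorems.SubdiffusiveBondHeat.EscapeGrading
open Summit.AtomisticToContinuum.FouriersLaw.Theorems.OddSectorIrreversibility
open Summit.AtomisticToContinuum.FouriersLaw.Theorems.BoundedResponse.TransientContact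
  (ExtensiveBlockEnergyVariance blockEnergyLeft blockEnergyLeftVar)
open Summit.AtomisticToContinuum.FouriersLaw.Cruxes.SuperadditiveResistance.FloatingProbeBypassLaplacian
  (integral_flip_gibbsMeasure integrable_flip_gibbsMeasure measurePreserving_flip_gibbsMeasure)

namespace Summit.AtomisticToContinuum.FouriersLaw.Theorems.BoundedResponse.ParityFloor

open Summit.AtomisticToContinuum.FouriersLaw.Theses.BondHeatUncertainty (BoundedResponse)
open Summit.AtomisticToContinuum.FouriersLaw.Theses.OddSectorIrreversibility (ConeScaleCorrector)
open Summit.AtomisticToContinuum.FouriersLaw.Theorems.NonBallistic (exists_totalCurrent_sq_le)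
open Summit.AtomisticToContinuum.FouriersLaw.Theorems.ExtensiveSnapshotIrreversibility.ClausiusBudget
  (leftEnergy_neg_momentum)
open Summit.AtomisticToContinuum.FouriersLaw.Cruxes.SuperadditiveResistance.InsertionToolbox (sq_integral_mul_le)

section OddSectorGreenKubo

variable {ω₂ lam β γ T : ℝ} {N : ℕ}

/-! ## §0 Parity bookkeeping under `Θ(q,p) = (q,−p)` (Cauchy–Schwarz is the tree's) -/

-- Cited, not restated (typer lint): the block energies `E_{≤i}` are even in the momenta — tree lemma
-- `ClausiusBudget.leftEnergy_neg_momentum`; Cauchy–Schwarz in `L²(μ)`, squared form — tree lemma `InsertionToolbox.sq_integral_mul_le`.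

/-- For `g` odd in the momenta: `∫ f(Θx)·g(x) dμ_T = −∫ f·g dμ_T` (no integrability needed: `Θ` preserves `μ_T`).
[folklore] -/
theorem integral_flip_mul_odd_gibbs (P : OscillatorChain) (N : ℕ) (T : ℝ) (f g : PhaseSpace N → ℝ)
    (hg : ∀ x : PhaseSpace N, g (x.1, -x.2) = -g x) :
    ∫ x, f (x.1, -x.2) * g x ∂(P.gibbsMeasure N T) = -∫ x, f x * g x ∂(P.gibbsMeasure N T) := by
  have h := integral_flip_gibbsMeasure P N T (fun x => f x * g (x.1, -x.2))
  simp only [neg_neg, Prod.mk.eta, hg, mul_neg, integral_neg] at h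
  exact h

/-- Even times odd integrates to zero against `μ_T`. [folklore] -/
theorem integral_even_mul_odd_gibbs (P : OscillatorChain) (N : ℕ) (T : ℝ) {f g : PhaseSpace N → ℝ}
    (hf : ∀ x : PhaseSpace N, f (x.1, -x.2) = f x) (hg : ∀ x : PhaseSpace N, g (x.1, -x.2) = -g x) :
    ∫ x, f x * g x ∂(P.gibbsMeasure N T) = 0 := by
  have h := integral_flip_mul_odd_gibbs P N T f g hg
  simp only [hf] at h
  linarith

/-- Only the odd part pairs with an odd observable: `⟨f, g⟩ = ½⟨f − f∘Θ, g⟩`. [folklore] -/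
theorem integral_mul_odd_eq_half_oddPart (P : OscillatorChain) (N : ℕ) (T : ℝ) {f g : PhaseSpace N → ℝ}
    (hg : ∀ x : PhaseSpace N, g (x.1, -x.2) = -g x)
    (hfg : Integrable (fun x => f x * g x) (P.gibbsMeasure N T))
    (hfg' : Integrable (fun x => f (x.1, -x.2) * g x) (P.gibbsMeasure N T)) :
    ∫ x, f x * g x ∂(P.gibbsMeasure N T) =
      (1 / 2) * ∫ x, (f x - f (x.1, -x.2)) * g x ∂(P.gibbsMeasure N T) := by
  have h := integral_flip_mul_odd_gibbs P N T f g hg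
  have e : ∫ x, (f x - f (x.1, -x.2)) * g x ∂(P.gibbsMeasure N T) =
      (∫ x, f x * g x ∂(P.gibbsMeasure N T)) - ∫ x, f (x.1, -x.2) * g x ∂(P.gibbsMeasure N T) := by
    rw [← integral_sub hfg hfg']
    refine integral_congr_ae (Eventually.of_forall fun x => ?_)
    ring
  rw [e, h]
  ring

/-! ## §1 The Green–Kubo pairing sees only the odd sector: `⟨u_N, J⟩ = −γ(N−1)⟨h₀, J⟩` -/

/-- **Committor form of the Green–Kubo pairing (fixed `N ≥ 2`).** `∫ u_N·J dμ_T = −γ(N−1)·∫ h₀·J dμ_T`: in the summed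
committor identity `u_N = Σ_b(E_{≤b} − ⟨E_{≤b}⟩) − γ(N−1)h₀` (`kinCorrector_committor_ae_eq`) the block-energy part is `Θ`-even
(`leftEnergy_neg_momentum`) and the total current is `Θ`-odd (`bondCurrent_neg_momentum`), so it drops out of the pairing.
[folklore] -/
theorem integral_totalKubo_mul_current_eq (hω : 0 < ω₂) (hl : 0 < lam) (hβ : 0 < β) (hγ : 0 < γ) (hT : 0 < T)
    (hN : 2 ≤ N) :
    ∫ z, (∫ s in Ioi (0 : ℝ), ∫ y, (∑ i : Fin N, (pinnedChain ω₂ lam β γ).bondCurrent N i y)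
          ∂((pinnedChain ω₂ lam β γ).transitionKernel N T T s.toNNReal z)) *
        (∑ i : Fin N, (pinnedChain ω₂ lam β γ).bondCurrent N i z) ∂((pinnedChain ω₂ lam β γ).gibbsMeasure N T) =
      -(γ * ((N : ℝ) - 1)) * ∫ z, kinCorrector ω₂ lam β γ T N ⟨0, by omega⟩ z *
        (∑ i : Fin N, (pinnedChain ω₂ lam β γ).bondCurrent N i z) ∂((pinnedChain ω₂ lam β γ).gibbsMeasure N T) := by
  have hN0 : 0 < N := by omega
  set P := pinnedChain ω₂ lam β γ with hP
  set π := P.gibbsMeasure N T with hπ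
  haveI : IsProbabilityMeasure π := pinnedChain_isProbabilityMeasure_gibbsMeasure hω hl.le hβ.le γ N hT
  set J : PhaseSpace N → ℝ := fun z => ∑ i : Fin N, P.bondCurrent N i z with hJ
  set h0 : PhaseSpace N → ℝ := kinCorrector ω₂ lam β γ T N ⟨0, hN0⟩ with hh0
  set uN : PhaseSpace N → ℝ := fun z => ∫ s in Ioi (0 : ℝ), ∫ y, J y
      ∂(P.transitionKernel N T T s.toNNReal z) with huN
  set S : Finset (Fin N) := Finset.univ.filter (fun i : Fin N => i.val + 1 < N) with hS
  set A : PhaseSpace N → ℝ := fun z => ∑ i ∈ S, (leftEnergy P N i z - ∫ x, leftEnergy P N i x ∂π) with hA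
  show ∫ z, uN z * J z ∂π = -(γ * ((N : ℝ) - 1)) * ∫ z, h0 z * J z ∂π
  -- the committor identity
  have hAe : ∀ᵐ z ∂π, γ * ((N : ℝ) - 1) * h0 z = A z - uN z :=
    kinCorrector_committor_ae_eq hω hl hβ hγ hT hN
  -- square-integrability of the four players
  obtain ⟨husm, husq, -, -⟩ := totalKubo_facts hω hl hβ hγ hT hN0
  change StronglyMeasurable uN at husm
  change Integrable (fun z => uN z ^ 2) π at husq
  obtain ⟨h0sm, h0sq, -, -⟩ := corrector_sq_facts hω hl.le hβ hγ hN0 hT (⟨0, hN0⟩ : Fin N)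
  have h0m : MemLp h0 2 π := (memLp_two_iff_integrable_sq h0sm.aestronglyMeasurable).2 h0sq
  have hJc : Continuous J := pinnedChain_continuous_sum_bondCurrent
  have hJ2 : Integrable (fun z => J z ^ 2) π := (pinnedChain_sq_act_sum_bondCurrent hω hl.le hβ hγ hN0 hT 0).1
  have hJm : MemLp J 2 π := (memLp_two_iff_integrable_sq hJc.aestronglyMeasurable).2 hJ2
  obtain ⟨CW, hCW⟩ := extensiveBlockEnergyVariance_holds ω₂ lam β γ hω hl hβ hγ T hT
  have hWm : ∀ i : Fin N, i.val + 1 < N → MemLp (leftEnergy P N i) 2 π := fun i hi => by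
    have h := (hCW N i.val hi).1
    rwa [blockEnergyLeft_eq_leftEnergy] at h
  have hmemS : ∀ {i : Fin N}, i ∈ S → i.val + 1 < N := fun {i} hi => by simpa [hS] using hi
  have hAm : MemLp A 2 π :=
    memLp_finsetSum S (f := fun i z => leftEnergy P N i z - ∫ x, leftEnergy P N i x ∂π)
      (fun i hi => (hWm i (hmemS hi)).sub (memLp_const _))
  -- parities
  have hJodd : ∀ x : PhaseSpace N, J (x.1, -x.2) = -J x := fun x => by
    simp only [hJ, OscillatorChain.bondCurrent_neg_momentum, Finset.sum_neg_distrib]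
  have hAeven : ∀ x : PhaseSpace N, A (x.1, -x.2) = A x := fun x => by
    simp only [hA, leftEnergy_neg_momentum]
  -- integrate the identity against `J`
  have hAJ : Integrable (fun z => A z * J z) π := hAm.integrable_mul hJm
  have hhJ : Integrable (fun z => h0 z * J z) π := h0m.integrable_mul hJm
  have hhJ' : Integrable (fun z => γ * ((N : ℝ) - 1) * (h0 z * J z)) π := hhJ.const_mul _
  have h1 : ∫ z, uN z * J z ∂π = ∫ z, (A z * J z - γ * ((N : ℝ) - 1) * (h0 z * J z)) ∂π := by
    refine integral_congr_ae ?_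
    filter_upwards [hAe] with z hz
    have e : uN z = A z - γ * ((N : ℝ) - 1) * h0 z := by linarith
    rw [e]
    ring
  have h2 : ∫ z, A z * J z ∂π = 0 := integral_even_mul_odd_gibbs P N T hAeven hJodd
  rw [h1, integral_sub hAJ hhJ', integral_const_mul, h2]
  ring

/-! ## §2 The response coefficient and the escape deficit as odd-corrector/current pairings -/

/-- ★ **Green–Kubo in corrector-parity form (fixed `N ≥ 2`).** Along ANY steady-state family and for ANY response coefficient
`D` of the `N`-chain at `T` (a limit of `J^tot(μ_{N,T+δ/2,T−δ/2})/δ`, `δ → 0`, `δ ≠ 0`):  `T²·D = −γ·⟨h₀, J⟩_{μ_T}` —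
`(N−1)T²D = Z⁻¹⟨u, J⟩_{e^{-H/T}}` (`CorrectorTheory` B, `pinnedChain_integral_corrector_mul_withDensity`, PROVED uniqueness
`bondHeatUncertainty_nessUnique_holds`), `u = u_N` a.e. (`totalKubo_facts`), and §1. [folklore] -/
theorem response_eq_neg_corrector_current_pairing (hω : 0 < ω₂) (hl : 0 < lam) (hβ : 0 < β) (hγ : 0 < γ)
    (μ : (n : ℕ) → ℝ → ℝ → Measure (PhaseSpace n))
    (hμ : ∀ (n : ℕ) (T_L T_R : ℝ), 0 < T_L → 0 < T_R →
      (pinnedChain ω₂ lam β γ).IsSteadyState n T_L T_R (μ n T_L T_R))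
    (hT : 0 < T) (hN : 2 ≤ N) {D : ℝ}
    (hD : Tendsto (fun δ : ℝ => (pinnedChain ω₂ lam β γ).totalCurrent (μ N (T + δ / 2) (T - δ / 2)) / δ)
      (𝓝[≠] 0) (𝓝 D)) :
    T ^ 2 * D = -γ * ∫ z, kinCorrector ω₂ lam β γ T N ⟨0, by omega⟩ z *
        (∑ i : Fin N, (pinnedChain ω₂ lam β γ).bondCurrent N i z) ∂((pinnedChain ω₂ lam β γ).gibbsMeasure N T) := by
  have hN0 : 0 < N := by omega
  have huniq := bondHeatUncertainty_nessUnique_holds ω₂ lam β γ hω hl hβ hγ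
  have hCT :=
    Summit.AtomisticToContinuum.FouriersLaw.Theorems.OddSectorIrreversibility.Corrector.CorrectorTheory_proof
  obtain ⟨u, hu1, hu2, hu3, hu4, h5, h6, h7⟩ := hCT.1 ω₂ lam β γ hω hl hβ hγ T hT N
  obtain ⟨hcI, hGKB⟩ := hCT.2 ω₂ lam β γ hω hl hβ hγ huniq μ hμ T hT N D hD
  simp only [] at hu1 hu2 hu3 hu4 h5 h6 h7 hcI hGKB
  clear h5 h6 h7 hu1
  have hpair := Summit.AtomisticToContinuum.FouriersLaw.Theorems.pinnedChain_integral_corrector_mul_withDensity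
    hω hl.le hβ hγ hN0 hT hu2 hu4 hcI
  have hT1 := integral_totalKubo_mul_current_eq hω hl hβ hγ hT hN
  obtain ⟨-, -, -, htend⟩ := totalKubo_facts hω hl hβ hγ hT hN0
  set P := pinnedChain ω₂ lam β γ with hP
  set π := P.gibbsMeasure N T with hπ
  set J : PhaseSpace N → ℝ := fun x => ∑ i : Fin N, P.bondCurrent N i x with hJ
  set Z : ℝ := ∫ x : PhaseSpace N, Real.exp (-(P.hamiltonian N x) / T) with hZ
  have hZpos : 0 < Z := OddResponseBound.Intensive.integral_gibbsWeight_pos hω hl.le hβ.le γ N hT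
  have hsmul := OddResponseBound.Intensive.withDensity_gibbs_eq_smul_gibbsMeasure hω hl.le hβ.le γ N hT
  have hc0 : ENNReal.ofReal Z ≠ 0 := (ENNReal.ofReal_pos.mpr hZpos).ne'
  -- `Z ∫ u J dπ = ∫ u J d(e^{-H/T}dx) = Z (N-1) T² D`
  have hGK : Z * ∫ x, u x * J x ∂π = Z * (((N : ℝ) - 1) * T ^ 2 * D) := by
    rw [hGKB, ← hpair.2, OddResponseBound.Intensive.integral_eq_toReal_mul_of_eq_smul hsmul,
      ENNReal.toReal_ofReal hZpos.le]
  have hGK' : ∫ x, u x * J x ∂π = ((N : ℝ) - 1) * T ^ 2 * D := mul_left_cancel₀ hZpos.ne' hGK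
  -- `u = u_N` `π`-a.e.
  have hlim := (OddResponseBound.Intensive.ae_smul_iff' hsmul hc0).mp hu3
  have hueq : ∀ᵐ x ∂π, u x = ∫ s in Ioi (0 : ℝ), ∫ y, J y ∂(P.transitionKernel N T T s.toNNReal x) := by
    filter_upwards [hlim] with x hx
    exact tendsto_nhds_unique hx (htend x)
  have h1 : ∫ x, u x * J x ∂π =
      ∫ x, (∫ s in Ioi (0 : ℝ), ∫ y, J y ∂(P.transitionKernel N T T s.toNNReal x)) * J x ∂π :=
    integral_congr_ae (hueq.mono fun x hx => by simp only [hx])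
  change ∫ x, (∫ s in Ioi (0 : ℝ), ∫ y, J y ∂(P.transitionKernel N T T s.toNNReal x)) * J x ∂π =
      -(γ * ((N : ℝ) - 1)) * ∫ z, kinCorrector ω₂ lam β γ T N ⟨0, hN0⟩ z * J z ∂π at hT1
  rw [h1, hT1] at hGK'
  -- cancel `N - 1`
  have hN1 : (0 : ℝ) < (N : ℝ) - 1 := by
    have h2 : (2 : ℝ) ≤ N := by exact_mod_cast hN
    linarith
  show T ^ 2 * D = -γ * ∫ z, kinCorrector ω₂ lam β γ T N ⟨0, hN0⟩ z * J z ∂π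
  have key : ((N : ℝ) - 1) * (T ^ 2 * D) =
      ((N : ℝ) - 1) * (-γ * ∫ z, kinCorrector ω₂ lam β γ T N ⟨0, hN0⟩ z * J z ∂π) := by
    linear_combination -hGK'
  exact mul_left_cancel₀ hN1.ne' key

/-- ★ **The escape deficit is an odd-corrector/current pairing (fixed `N ≥ 2`):** `E_N = −⟨h₀, J⟩_{μ_T}/(T²(N−1))` — the
PROVED response identity `D_N = (N−1)γE_N` (`boundaryEscapeDeficit_responseIdentity_holds`) along the canonical steady-state
family (`pinnedChain_exists_isSteadyState`). [folklore] -/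
theorem escapeDeficit_eq_neg_corrector_current_pairing (hω : 0 < ω₂) (hl : 0 < lam) (hβ : 0 < β) (hγ : 0 < γ)
    (hT : 0 < T) (hN : 2 ≤ N) :
    escapeDeficit ω₂ lam β γ T N = -(1 / (T ^ 2 * ((N : ℝ) - 1))) *
      ∫ z, kinCorrector ω₂ lam β γ T N ⟨0, by omega⟩ z *
        (∑ i : Fin N, (pinnedChain ω₂ lam β γ).bondCurrent N i z) ∂((pinnedChain ω₂ lam β γ).gibbsMeasure N T) := by
  classical
  have hN0 : 0 < N := by omega
  have huniq := bondHeatUncertainty_nessUnique_holds ω₂ lam β γ hω hl hβ hγ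
  -- the canonical steady-state family
  let μ₀ : (n : ℕ) → ℝ → ℝ → Measure (PhaseSpace n) := fun n T_L T_R =>
    if h : 0 < T_L ∧ 0 < T_R then
      Classical.choose (pinnedChain_exists_isSteadyState hω hl hβ hγ n h.1 h.2) else 0
  have hμ₀ : ∀ (n : ℕ) (T_L T_R : ℝ), 0 < T_L → 0 < T_R →
      (pinnedChain ω₂ lam β γ).IsSteadyState n T_L T_R (μ₀ n T_L T_R) := by
    intro n T_L T_R hL' hR'
    simp only [μ₀, dif_pos (And.intro hL' hR')]
    exact Classical.choose_spec (pinnedChain_exists_isSteadyState hω hl hβ hγ n hL' hR')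
  have hRI := boundaryEscapeDeficit_responseIdentity_holds ω₂ lam β γ hω hl hβ hγ huniq μ₀ hμ₀ T hT
  dsimp only at hRI
  have hD : Tendsto (fun δ : ℝ => (pinnedChain ω₂ lam β γ).totalCurrent (μ₀ N (T + δ / 2) (T - δ / 2)) / δ)
      (𝓝[≠] 0) (𝓝 (((N : ℝ) - 1) * γ * escapeDeficit ω₂ lam β γ T N)) := (hRI N hN0).2
  have h := response_eq_neg_corrector_current_pairing hω hl hβ hγ μ₀ hμ₀ hT hN hD
  set X := ∫ z, kinCorrector ω₂ lam β γ T N ⟨0, hN0⟩ z *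
        (∑ i : Fin N, (pinnedChain ω₂ lam β γ).bondCurrent N i z) ∂((pinnedChain ω₂ lam β γ).gibbsMeasure N T) with hX
  have hN1 : (0 : ℝ) < (N : ℝ) - 1 := by
    have h2 : (2 : ℝ) ≤ N := by exact_mod_cast hN
    linarith
  have hc0 : T ^ 2 * ((N : ℝ) - 1) ≠ 0 := by positivity
  have key : escapeDeficit ω₂ lam β γ T N * (T ^ 2 * ((N : ℝ) - 1)) = -X := by
    have h' : γ * (escapeDeficit ω₂ lam β γ T N * (T ^ 2 * ((N : ℝ) - 1))) = γ * (-X) := by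
      linear_combination h
    exact mul_left_cancel₀ hγ.ne' h'
  calc escapeDeficit ω₂ lam β γ T N
      = escapeDeficit ω₂ lam β γ T N * (T ^ 2 * ((N : ℝ) - 1)) / (T ^ 2 * ((N : ℝ) - 1)) := by
        rw [mul_div_cancel_right₀ _ hc0]
    _ = -X / (T ^ 2 * ((N : ℝ) - 1)) := by rw [key]
    _ = -(1 / (T ^ 2 * ((N : ℝ) - 1))) * X := by ring

/-- ★ **Odd form:** `E_N = −⟨h₀ − h₀∘Θ, J⟩_{μ_T}/(2T²(N−1))` — only the `Θ`-odd part of `h₀` pairs with the odd `J`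
(`integral_mul_odd_eq_half_oddPart`). [folklore] -/
theorem escapeDeficit_eq_oddCorrector_current_pairing (hω : 0 < ω₂) (hl : 0 < lam) (hβ : 0 < β) (hγ : 0 < γ)
    (hT : 0 < T) (hN : 2 ≤ N) :
    escapeDeficit ω₂ lam β γ T N = -(1 / (2 * T ^ 2 * ((N : ℝ) - 1))) *
      ∫ z, (kinCorrector ω₂ lam β γ T N ⟨0, by omega⟩ z - kinCorrector ω₂ lam β γ T N ⟨0, by omega⟩ (z.1, -z.2)) *
        (∑ i : Fin N, (pinnedChain ω₂ lam β γ).bondCurrent N i z) ∂((pinnedChain ω₂ lam β γ).gibbsMeasure N T) := by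
  have hN0 : 0 < N := by omega
  rw [escapeDeficit_eq_neg_corrector_current_pairing hω hl hβ hγ hT hN]
  set P := pinnedChain ω₂ lam β γ with hP
  set π := P.gibbsMeasure N T with hπ
  set J : PhaseSpace N → ℝ := fun z => ∑ i : Fin N, P.bondCurrent N i z with hJ
  set h0 : PhaseSpace N → ℝ := kinCorrector ω₂ lam β γ T N ⟨0, hN0⟩ with hh0
  show -(1 / (T ^ 2 * ((N : ℝ) - 1))) * ∫ z, h0 z * J z ∂π =
      -(1 / (2 * T ^ 2 * ((N : ℝ) - 1))) * ∫ z, (h0 z - h0 (z.1, -z.2)) * J z ∂π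
  obtain ⟨h0sm, h0sq, h0sm', h0sq'⟩ := corrector_sq_facts hω hl.le hβ hγ hN0 hT (⟨0, hN0⟩ : Fin N)
  have h0m : MemLp h0 2 π := (memLp_two_iff_integrable_sq h0sm.aestronglyMeasurable).2 h0sq
  have h0m' : MemLp (fun z : PhaseSpace N => h0 (z.1, -z.2)) 2 π :=
    (memLp_two_iff_integrable_sq h0sm'.aestronglyMeasurable).2 h0sq'
  have hJc : Continuous J := pinnedChain_continuous_sum_bondCurrent
  have hJ2 : Integrable (fun z => J z ^ 2) π := (pinnedChain_sq_act_sum_bondCurrent hω hl.le hβ hγ hN0 hT 0).1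
  have hJm : MemLp J 2 π := (memLp_two_iff_integrable_sq hJc.aestronglyMeasurable).2 hJ2
  have hJodd : ∀ x : PhaseSpace N, J (x.1, -x.2) = -J x := fun x => by
    simp only [hJ, OscillatorChain.bondCurrent_neg_momentum, Finset.sum_neg_distrib]
  rw [integral_mul_odd_eq_half_oddPart P N T hJodd (h0m.integrable_mul hJm) (h0m'.integrable_mul hJm)]
  have hN1 : (0 : ℝ) < (N : ℝ) - 1 := by
    have h2 : (2 : ℝ) ≤ N := by exact_mod_cast hN
    linarith
  have hT0 : T ≠ 0 := hT.ne'
  have hN1' : (N : ℝ) - 1 ≠ 0 := hN1.ne'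
  field_simp
  ring

end OddSectorGreenKubo

end Summit.AtomisticToContinuum.FouriersLaw.Theorems.BoundedResponse.ParityFloor

end
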